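import Literature.Probability.RandomPlanarGeometry.SAWTileMerge
import Literature.Probability.LatticeModels.LatticeAnimalsGraph
import Mathlib.Algebra.BigOperators.Ring.Finset
import HarnessLib

/-!
# Connected families of tiles: attachment sequences and the product structure of the merged
# excursions (`Z_F(x) ≥ x^{(4r+2)(|F|-1)} Z_m(x)^{|F|}`)

H. Duminil-Copin, G. Kozma, A. Yadin, *Supercritical self-avoiding walks are space-filling*,
Ann. IHP Probab. Stat. 50 (2014), §3, proof of Proposition 7, Claim: "for `F ∈ 𝓕(Ω_δ,m)`,
`Z_F(x) ≥ Z_m(x)^{|F|}`. We prove it by induction … There exists a box `B` in `F₀` such that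
`F₀ ∖ {B}` is still connected … the construction is one-to-one and we deduce
`Z_{F₀}(x) ≥ Z_{F₀∖{B}}(x) Z_B(x) ≥ Z_m(x)^{|F₀|}`." Over the odd tiles of `SAWTiles.lean` and the
merged excursion `OddTile.mergeList` of `SAWTileMerge.lean` this file supplies:

* `OddTile.exists_validFrom` — a connected family `F` of tiles (cut form
  `LatticeModels.IsGraphConnected (zdGraph 2) F`) containing `t` and avoiding `t'` admits a
  valid attachment sequence from `t` (`OddTile.ValidFrom t' [t] steps`) enumerating exactly `F`
  (grow a maximal enumerated sub-family; the printed induction on `|F|`);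
* `OddTile.configs F` — the assignments of a tile polygon to every tile of `F`, with
  `Σ_{P} x^{Σ_τ #P_τ} = Z_m(x)^{|F|}` (`OddTile.sum_configs_pow`);
* for a valid attachment sequence enumerating `F`: the merged excursion of an assignment has
  `Σ_τ #P_τ + (4r+2)(|F|-1)` vertices (`OddTile.length_mergeList_toAssign`) and determines the
  assignment (`OddTile.mergeList_toAssign_injOn`), whence the product structure
  `Σ_P x^{|mergeList P|} = x^{(4r+2)(|F|-1)} Z_m(x)^{|F|}` (`OddTile.sum_configs_pow_length`) —
  the Claim with the merge cost of the margins made explicit.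
-/

noncomputable section

open Finset Literature.Probability.LatticeModels

namespace Literature.Probability.RandomPlanarGeometry.SAW

namespace OddTile

variable {m r : ℕ}

/-! ### Directions of lattice steps -/

/-- A lattice step is a step in one of the four directions. [folklore] -/
theorem exists_dir_of_adj {a b : Site 2} (h : (zdGraph 2).Adj a b) : ∃ d : Dir, b = a + d.vec := by
  rw [adj_iff_coord] at h
  rcases h with ⟨h0 | h0, h1⟩ | ⟨h1 | h1, h0⟩
  · exact ⟨.E, by rw [site_eq_iff]; simp [Dir.vec]; omega⟩
  · exact ⟨.W, by rw [site_eq_iff]; simp [Dir.vec]; omega⟩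
  · exact ⟨.N, by rw [site_eq_iff]; simp [Dir.vec]; omega⟩
  · exact ⟨.S, by rw [site_eq_iff]; simp [Dir.vec]; omega⟩

/-! ### Valid attachment sequences: appending a step, the tiles -/

/-- The tiles after no step. [folklore] -/
@[simp] theorem tilesAfter_nil (T : List (Site 2)) : tilesAfter T [] = T := by simp [tilesAfter]

/-- The tiles after one more step. [folklore] -/
theorem tilesAfter_append_singleton (T : List (Site 2)) (steps : List (Site 2 × Dir))
    (p : Site 2 × Dir) : tilesAfter T (steps ++ [p]) = tilesAfter T steps ++ [newTile p] := by
  simp [tilesAfter]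

/-- The tiles after the steps, from a larger initial family. [folklore] -/
theorem tilesAfter_cons_eq (T : List (Site 2)) (p : Site 2 × Dir) (steps : List (Site 2 × Dir)) :
    tilesAfter (T ++ [newTile p]) steps = tilesAfter T (p :: steps) := by
  simp [tilesAfter]

/-- The number of tiles after the steps. [folklore] -/
@[simp] theorem length_tilesAfter (T : List (Site 2)) (steps : List (Site 2 × Dir)) :
    (tilesAfter T steps).length = T.length + steps.length := by
  simp [tilesAfter]

/-- Validity of a sequence extended by one step at the end. [folklore] -/
theorem validFrom_append_singleton {forb : Site 2} :
    ∀ {T : List (Site 2)} {steps : List (Site 2 × Dir)} {p : Site 2 × Dir},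
      ValidFrom forb T (steps ++ [p]) ↔
        ValidFrom forb T steps ∧ p.1 ∈ tilesAfter T steps ∧ newTile p ∉ tilesAfter T steps ∧
          newTile p ≠ forb
  | T, [], p => by simp [ValidFrom, tilesAfter]
  | T, q :: steps, p => by
    rw [List.cons_append, ValidFrom, ValidFrom, validFrom_append_singleton, tilesAfter_cons_eq]
    tauto

/-- The tiles of a valid sequence are distinct. [folklore] -/
theorem nodup_tilesAfter_of_validFrom {forb : Site 2} :
    ∀ {T : List (Site 2)} {steps : List (Site 2 × Dir)}, T.Nodup → ValidFrom forb T steps →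
      (tilesAfter T steps).Nodup
  | T, [], hT, _ => by simpa using hT
  | T, p :: steps, hT, hv => by
    obtain ⟨-, hp2, -, hv'⟩ := hv
    rw [← tilesAfter_cons_eq]
    refine nodup_tilesAfter_of_validFrom ?_ hv'
    rw [List.nodup_append]
    exact ⟨hT, by simp, fun x hx y hy hxy => hp2 (by simp only [List.mem_singleton] at hy; rwa [← hy, ← hxy])⟩

/-- **A connected family admits a valid attachment sequence from any of its tiles**
(avoiding a given tile outside the family), enumerating the family without repetition: grow an
enumerated sub-family; while it is a proper part, connectedness of `F` (cut form) provides an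
edge from it to the rest, i.e. one more valid step. [cite: DuminilCopinKozmaYadin2014, §3 (proof of the Claim: induction on |F|)] -/
theorem exists_validFrom {F : Finset (Site 2)} (hF : IsGraphConnected (zdGraph 2) F) {t : Site 2}
    (ht : t ∈ F) {t' : Site 2} (ht' : t' ∉ F) :
    ∃ steps : List (Site 2 × Dir), ValidFrom t' [t] steps ∧ (tilesAfter [t] steps).Nodup ∧
      (tilesAfter [t] steps).toFinset = F ∧ steps.length + 1 = F.card := by
  classical
  -- for every `k < #F` there is a valid sequence of `k` steps inside `F`
  have key : ∀ k : ℕ, k < F.card → ∃ steps : List (Site 2 × Dir), steps.length = k ∧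
      ValidFrom t' [t] steps ∧ ∀ τ ∈ tilesAfter [t] steps, τ ∈ F := by
    intro k
    induction k with
    | zero => intro _; exact ⟨[], rfl, trivial, by simpa [tilesAfter] using ht⟩
    | succ k ih =>
      intro hk
      obtain ⟨steps, hlen, hv, hsub⟩ := ih (by omega)
      set G := (tilesAfter [t] steps).toFinset with hG
      have hGsub : G ⊆ F := fun τ hτ => hsub τ (List.mem_toFinset.1 hτ)
      have hGne : G.Nonempty := ⟨t, by simp [hG, tilesAfter]⟩
      have hnd : (tilesAfter [t] steps).Nodup := nodup_tilesAfter_of_validFrom (by simp) hv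
      have hGcard : G.card = k + 1 := by
        rw [hG, List.toFinset_card_of_nodup hnd, length_tilesAfter, hlen]; simp [add_comm]
      have hrest : (F \ G).Nonempty := by
        rw [← Finset.card_pos, Finset.card_sdiff_of_subset hGsub]; omega
      obtain ⟨a, ha, b, hb, hab⟩ := hF G hGsub hGne hrest
      obtain ⟨d, rfl⟩ := exists_dir_of_adj hab
      rw [Finset.mem_sdiff] at hb
      refine ⟨steps ++ [(a, d)], by simp [hlen], ?_, ?_⟩
      · rw [validFrom_append_singleton]
        refine ⟨hv, List.mem_toFinset.1 ha, fun h => hb.2 (List.mem_toFinset.2 h), ?_⟩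
        exact fun h => ht' (h ▸ hb.1)
      · intro τ hτ
        rw [tilesAfter_append_singleton, List.mem_append, List.mem_singleton] at hτ
        rcases hτ with hτ | rfl
        · exact hsub τ hτ
        · exact hb.1
  have hpos : 0 < F.card := Finset.card_pos.2 ⟨t, ht⟩
  obtain ⟨steps, hlen, hv, hsub⟩ := key (F.card - 1) (by omega)
  have hnd : (tilesAfter [t] steps).Nodup := nodup_tilesAfter_of_validFrom (by simp) hv
  refine ⟨steps, hv, hnd, ?_, by omega⟩
  apply Finset.eq_of_subset_of_card_le (fun τ hτ => hsub τ (List.mem_toFinset.1 hτ))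
  rw [List.toFinset_card_of_nodup hnd, length_tilesAfter, hlen]
  simp only [List.length_singleton]
  omega

/-! ### Assignments of polygons to the tiles of a family -/

variable (m r) in
/-- The assignments of a tile polygon (an element of `tilePolygons m r τ`) to every tile `τ` of
the family `F`. [cite: DuminilCopinKozmaYadin2014, §3 (proof of the Claim: a polygon of P_m in each box)] -/
def configs (F : Finset (Site 2)) : Finset (∀ τ ∈ F, Finset (Sym2 (Site 2))) :=
  F.pi fun τ => tilePolygons m r τ

/-- The total polygon assignment of a config (junk `∅` outside the family). [folklore] -/
def toAssign (F : Finset (Site 2)) (p : ∀ τ ∈ F, Finset (Sym2 (Site 2))) :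
    Site 2 → Finset (Sym2 (Site 2)) :=
  fun τ => if h : τ ∈ F then p τ h else ∅

/-- On the family the total assignment is the config. [folklore] -/
theorem toAssign_of_mem {F : Finset (Site 2)} (p : ∀ τ ∈ F, Finset (Sym2 (Site 2))) {τ : Site 2}
    (h : τ ∈ F) : toAssign F p τ = p τ h := by
  simp [toAssign, h]

/-- Members of `configs` assign tile polygons. [folklore] -/
theorem toAssign_mem_tilePolygons {F : Finset (Site 2)} {p : ∀ τ ∈ F, Finset (Sym2 (Site 2))}
    (hp : p ∈ configs m r F) {τ : Site 2} (h : τ ∈ F) : toAssign F p τ ∈ tilePolygons m r τ := by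
  rw [toAssign_of_mem p h]
  exact Finset.mem_pi.1 hp τ h

/-- **The generating function of the assignments is `Z_m(x)^{|F|}`.**
[cite: DuminilCopinKozmaYadin2014, §3 (proof of the Claim)] -/
theorem sum_configs_pow (F : Finset (Site 2)) (x : ℝ) :
    ∑ p ∈ configs m r F, x ^ (∑ τ ∈ F.attach, (p τ.1 τ.2).card) = Zbox m x ^ F.card := by
  have h := Finset.prod_sum F (fun τ => tilePolygons m r τ) fun τ E => x ^ E.card
  simp only [sum_tilePolygons, Finset.prod_const] at h
  rw [h, configs]
  refine Finset.sum_congr rfl fun p _ => ?_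
  rw [Finset.prod_pow_eq_pow_sum]

/-! ### The merged excursions of the assignments -/

/-- The length of the merged excursion of an assignment: `Σ_τ #P_τ + (4r+2)·(number of
attachments)`. [cite: DuminilCopinKozmaYadin2014, §3 (proof of the Claim)] -/
theorem length_mergeList_toAssign {F : Finset (Site 2)} {t₀ : Site 2} {d₀ : Dir} {t' : Site 2}
    {steps : List (Site 2 × Dir)} (hv : ValidFrom t' [t₀] steps) (ht' : t' = t₀ + d₀.vec)
    (hnd : (tilesAfter [t₀] steps).Nodup) (hF : (tilesAfter [t₀] steps).toFinset = F)
    {p : ∀ τ ∈ F, Finset (Sym2 (Site 2))} (hp : p ∈ configs m r F) :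
    (mergeList m r (toAssign F p) t₀ d₀ steps).length =
      ∑ τ ∈ F.attach, (p τ.1 τ.2).card + (4 * r + 2) * steps.length := by
  have ht₀ : t₀ ∈ F := by rw [← hF]; simp [tilesAfter]
  have hsteps : ∀ q ∈ steps, newTile q ∈ F := fun q hq => by
    rw [← hF, List.mem_toFinset, tilesAfter]
    exact List.mem_append_right _ (List.mem_map_of_mem hq)
  have hI := MergeInv.mergeList (P := toAssign F p) (m := m) (r := r) (d₀ := d₀) (ht' ▸ hv)
    (toAssign_mem_tilePolygons hp ht₀) fun q hq => toAssign_mem_tilePolygons hp (hsteps q hq)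
  rw [hI.len]
  congr 1
  -- the list sum over the enumeration is the sum over `F`
  have hmap : (entries t₀ d₀ steps).map (fun q => (toAssign F p q.1).card) =
      (tilesAfter [t₀] steps).map fun τ => (toAssign F p τ).card := by
    rw [← map_fst_entries, List.map_map]; rfl
  rw [hmap, ← List.sum_toFinset _ hnd, hF, ← Finset.sum_attach]
  exact Finset.sum_congr rfl fun τ _ => by rw [toAssign_of_mem p τ.2]

/-- **The merged excursion determines the assignment** (on a valid attachment sequence
enumerating the family). [cite: DuminilCopinKozmaYadin2014, §3 (proof of the Claim: "the construction is one-to-one")] -/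
theorem mergeList_toAssign_injOn {F : Finset (Site 2)} {t₀ : Site 2} {d₀ : Dir} {t' : Site 2}
    {steps : List (Site 2 × Dir)} (hv : ValidFrom t' [t₀] steps) (ht' : t' = t₀ + d₀.vec)
    (hF : (tilesAfter [t₀] steps).toFinset = F) :
    Set.InjOn (fun p => mergeList m r (toAssign F p) t₀ d₀ steps) (configs m r F) := by
  intro p hp p' hp' h
  have hmemF : ∀ q ∈ entries t₀ d₀ steps, q.1 ∈ F := fun q hq => by
    rw [← hF, List.mem_toFinset, ← map_fst_entries]
    exact List.mem_map_of_mem hq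
  have key := mergeList_inj (m := m) (r := r) (ht' ▸ hv)
    (fun q hq => toAssign_mem_tilePolygons hp (hmemF q hq))
    (fun q hq => toAssign_mem_tilePolygons hp' (hmemF q hq)) h
  funext τ hτ
  -- `τ ∈ F` is some `q.1`
  have : ∃ q ∈ entries t₀ d₀ steps, q.1 = τ := by
    have hτ' : τ ∈ (entries t₀ d₀ steps).map Prod.fst := by
      rw [map_fst_entries, ← List.mem_toFinset, hF]; exact hτ
    simpa using hτ'
  obtain ⟨q, hq, rfl⟩ := this
  have e := key q hq
  rwa [toAssign_of_mem p hτ, toAssign_of_mem p' hτ] at e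

/-- **The product structure** (the Claim `Z_F(x) ≥ Z_m(x)^{|F|}` with the margins' merge cost
explicit): summing `x^{|merged excursion|}` over the assignments gives
`x^{(4r+2)(|F|-1)} Z_m(x)^{|F|}`. [cite: DuminilCopinKozmaYadin2014, §3 (proof of Proposition 7, Claim)] -/
theorem sum_configs_pow_length {F : Finset (Site 2)} {t₀ : Site 2} {d₀ : Dir} {t' : Site 2}
    {steps : List (Site 2 × Dir)} (hv : ValidFrom t' [t₀] steps) (ht' : t' = t₀ + d₀.vec)
    (hnd : (tilesAfter [t₀] steps).Nodup) (hF : (tilesAfter [t₀] steps).toFinset = F) (x : ℝ) :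
    ∑ p ∈ configs m r F, x ^ (mergeList m r (toAssign F p) t₀ d₀ steps).length =
      x ^ ((4 * r + 2) * (F.card - 1)) * Zbox m x ^ F.card := by
  have hcard : steps.length = F.card - 1 := by
    rw [← hF, List.toFinset_card_of_nodup hnd, length_tilesAfter]; simp
  rw [← sum_configs_pow (m := m) (r := r) F x, Finset.mul_sum]
  refine Finset.sum_congr rfl fun p hp => ?_
  rw [length_mergeList_toAssign hv ht' hnd hF hp, pow_add, hcard, mul_comm]

end OddTile

end Literature.Probability.RandomPlanarGeometry.SAW
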